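import Mathlib
import Summits.Ventures.HodgeRepro2.T5IwasawaLimit
import Summits.Ventures.HodgeRepro2.T5AmiceConvolution

/-!
# T5IwasawaLimitRing — the RING structure of the inverse limit lim_k W[ℤ/p^k], and
«W[[Γ_𝔭]] ≅ W[[T]] (γ₀ ↦ 1 + T)» AS RINGS with the group ring as printed

Tier-5 support for route-3's §G (route/T5-CHECK-G-p7.md §3 S5, §21.4, §22.4): T5IwasawaLimit
identified the inverse limit of the group rings with the bounded measures and with the bounded
power series ADDITIVELY; the multiplicative structure was left open.  This file closes it:

* `levelMul v w k c := Σ_{a ∈ ℤ/p^k} v k a · w k (c − a)` — the group-ring product of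
  A[ℤ/p^k] at every level (Σ_a v_a[a] · Σ_b w_b[b] = Σ_c (Σ_{a+b=c} v_a w_b)[c]);
* **`dist_conv`** — the distribution of the CONVOLUTION of two measures (p401350's `conv`, the
  product of p401503's `BoundedMeasure`) is the level-wise group-ring product of their
  distributions: a shift of a class indicator is a class indicator (`shift_indicatorCM_resClass`),
  so the partial integral of `1_{c + p^kℤ_p}` is `Σ_a m₂(1_{(c−a) + p^kℤ_p})·1_{a + p^kℤ_p}`;
* `IwasawaRing p A` — the inverse limit with the ring structure transported from the measures
  (`distRingEquiv : BoundedMeasure p A ≃+* IwasawaRing p A`), whose product IS the group-ring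
  product (**`mul_val`**) and whose unit is the system `(δ_{0 mod p^k})_k` = [0] (`one_val`);
* **`iwasawaAmiceRing : IwasawaRing p A ≃+* boundedSeries A`** and, over a discrete valuation
  ring with valuation norm, **`iwasawaAmiceRingDVR : IwasawaRing p A ≃+* PowerSeries A`** with
  γ₀ ↦ 1 + T — S5's «m ∈ W[[Γ_𝔭]] ≅ W[[T]] (γ₀ ↦ 1 + T)» as rings, the group ring being
  lim_k W[ℤ/p^k] with its level-wise multiplication.

No printed input is consumed.  §8(d): uses an L-value-free non-vanishing device: NO.
-/

namespace Summit.Ventures.HodgeRepro2.T5IwasawaLimitRing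

open Summit.Ventures.HodgeRepro2.T5MeasureSupOnClopens (indicatorCM indicatorCM_apply)
open Summit.Ventures.HodgeRepro2.T5MeasureDistribution
open Summit.Ventures.HodgeRepro2.T5DistributionMeasure
open Summit.Ventures.HodgeRepro2.T5IwasawaLimit
open Summit.Ventures.HodgeRepro2.T5AmiceRingEquiv
open Summit.Ventures.HodgeRepro2.T5AmiceConvolution
open Summit.Ventures.HodgeRepro2.T5MuInvariantDVR (NormDict)
open Finset

variable {p : ℕ} [Fact (Nat.Prime p)]

section LevelMul

variable (p) (A : Type*) [NormedCommRing A]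

/-- The level-wise group-ring product of two systems of functions on the quotients ℤ/p^k:
`(v ⋆ w) k c = Σ_{a ∈ ℤ/p^k} v k a · w k (c − a)`. -/
def levelMul (v w : ∀ k : ℕ, ZMod (p ^ k) → A) : ∀ k : ℕ, ZMod (p ^ k) → A :=
  fun k c => ∑ a : ZMod (p ^ k), v k a * w k (c - a)

variable {p A}

/-- `levelMul v w k c = Σ_a v k a * w k (c − a)`. -/
theorem levelMul_apply (v w : ∀ k : ℕ, ZMod (p ^ k) → A) (k : ℕ) (c : ZMod (p ^ k)) :
    levelMul p A v w k c = ∑ a : ZMod (p ^ k), v k a * w k (c - a) := rfl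

/-- A shift of a class indicator is a class indicator: `1_{c + p^kℤ_p}(y + x) = 1_{(c − x̄) + p^kℤ_p}(y)`. -/
theorem shift_indicatorCM_resClass (x : ℤ_[p]) (k : ℕ) (c : ZMod (p ^ k)) :
    shift x (indicatorCM (resClass k c) : C(ℤ_[p], A)) =
      indicatorCM (resClass k (c - PadicInt.toZModPow k x)) := by
  classical
  ext y
  rw [shift_apply, indicatorCM_apply (isClopen_resClass _ _), indicatorCM_apply (isClopen_resClass _ _),
    Set.indicator_apply, Set.indicator_apply, mem_resClass_iff, mem_resClass_iff, map_add]
  congr 1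
  exact propext eq_sub_iff_add_eq.symm

/-- The partial integral of a class indicator against `m` is a finite combination of class
indicators: `∫ 1_{c + p^kℤ_p}(x + y) dm(y) = Σ_a m(1_{(c−a) + p^kℤ_p})·1_{a + p^kℤ_p}(x)`. -/
theorem partialInt_indicatorCM_resClass (m : C(ℤ_[p], A) →ₗ[A] A) (hm : Continuous m) (k : ℕ)
    (c : ZMod (p ^ k)) :
    partialInt m hm (indicatorCM (resClass k c)) =
      ∑ a : ZMod (p ^ k), dist m k (c - a) • (indicatorCM (resClass k a) : C(ℤ_[p], A)) := by
  ext x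
  rw [partialInt_apply, shift_indicatorCM_resClass, ← dist_apply]
  simp only [ContinuousMap.coe_sum, Finset.sum_apply, ContinuousMap.smul_apply, smul_eq_mul,
    indicatorCM_apply (isClopen_resClass _ _)]
  rw [Finset.sum_eq_single_of_mem (PadicInt.toZModPow k x) (Finset.mem_univ _)
    (fun b _ hb => by rw [indicator_resClass_of_ne (Ne.symm hb), mul_zero]),
    Set.indicator_of_mem (resClass_toZModPow_self k x), Pi.one_apply, mul_one]

/-- THE DISTRIBUTION OF A CONVOLUTION IS THE GROUP-RING PRODUCT OF THE DISTRIBUTIONS: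
`dist (m₁ * m₂) k c = Σ_a dist m₁ k a · dist m₂ k (c − a)`. -/
theorem dist_conv (m₁ m₂ : C(ℤ_[p], A) →ₗ[A] A) (hm₂ : Continuous m₂) (k : ℕ)
    (c : ZMod (p ^ k)) :
    dist (conv m₁ m₂ hm₂) k c = levelMul p A (dist m₁) (dist m₂) k c := by
  rw [dist_apply, conv_apply, partialInt_indicatorCM_resClass, map_sum, levelMul_apply]
  exact Finset.sum_congr rfl fun a _ => by rw [map_smul, smul_eq_mul, ← dist_apply, mul_comm]

/-- `dist (conv m₁ m₂) = levelMul (dist m₁) (dist m₂)`. -/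
theorem dist_conv_eq (m₁ m₂ : C(ℤ_[p], A) →ₗ[A] A) (hm₂ : Continuous m₂) :
    dist (conv m₁ m₂ hm₂) = levelMul p A (dist m₁) (dist m₂) :=
  funext fun k => funext fun c => dist_conv m₁ m₂ hm₂ k c

end LevelMul

section Ring

variable {A : Type*} [NormedCommRing A] [Algebra ℤ_[p] A] [IsBoundedSMul ℤ_[p] A]
  [IsUltrametricDist A] [CompleteSpace A] [NormOneClass A]

/-- `distB` turns the product of bounded measures (convolution) into the level-wise group-ring
product. -/
theorem distB_mul (m₁ m₂ : BoundedMeasure p A) :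
    ((distB (m₁ * m₂) : iwasawaLimit p A) : ∀ k : ℕ, ZMod (p ^ k) → A) =
      levelMul p A (distB m₁ : iwasawaLimit p A) (distB m₂ : iwasawaLimit p A) := by
  rw [distB_val, distB_val, distB_val, mul_val_eq_conv, dist_conv_eq]

/-- The level-wise product of two elements of the limit is in the limit (it is the distribution
of the convolution of the corresponding measures). -/
theorem levelMul_mem (v w : iwasawaLimit p A) :
    levelMul p A (v : ∀ k : ℕ, ZMod (p ^ k) → A) (w : ∀ k : ℕ, ZMod (p ^ k) → A) ∈ iwasawaLimit p A := by
  have hv := distB_ofLimit v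
  have hw := distB_ofLimit w
  rw [← hv, ← hw, ← distB_mul]
  exact (distB (ofLimit v * ofLimit w)).2

/-- The inverse limit `lim_k A[ℤ/p^k]` (bounded part) WITH ITS RING STRUCTURE: the structure is
transported from the bounded measures along `distAddEquiv`; its product is the level-wise
group-ring product (`mul_val`) and its unit is the system `[0]` (`one_val`). -/
def IwasawaRing (p : ℕ) [Fact (Nat.Prime p)] (A : Type*) [NormedCommRing A] : Type _ :=
  iwasawaLimit p A

/-- The limit-to-measures equivalence, on the ring synonym. -/
noncomputable def toMeasureEquiv : IwasawaRing p A ≃ BoundedMeasure p A :=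
  (distAddEquiv (p := p) (A := A)).symm.toEquiv

/-- The commutative ring structure of `IwasawaRing p A`, transported from the bounded measures
(convolution) along `toMeasureEquiv`. -/
noncomputable instance instCommRingIwasawaRing : CommRing (IwasawaRing p A) :=
  (toMeasureEquiv (p := p) (A := A)).commRing

/-- The ring isomorphism `BoundedMeasure p A ≃+* IwasawaRing p A`. -/
noncomputable def distRingEquiv : BoundedMeasure p A ≃+* IwasawaRing p A :=
  (toMeasureEquiv (p := p) (A := A)).ringEquiv.symm

/-- An element of the ring, as an element of the additive limit. -/
def IwasawaRing.toLimit (x : IwasawaRing p A) : iwasawaLimit p A := x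

/-- The underlying system of an element of the ring. -/
def IwasawaRing.val (x : IwasawaRing p A) : ∀ k : ℕ, ZMod (p ^ k) → A :=
  Subtype.val x.toLimit

/-- `distRingEquiv m` has the values of `m` on the residue classes. -/
theorem distRingEquiv_val (m : BoundedMeasure p A) :
    (distRingEquiv m : IwasawaRing p A).val = dist (m : C(ℤ_[p], A) →ₗ[A] A) := rfl

/-- The product of the limit is the level-wise group-ring product. -/
theorem mul_val (x y : IwasawaRing p A) : (x * y).val = levelMul p A x.val y.val := by
  obtain ⟨m, rfl⟩ := distRingEquiv.surjective x
  obtain ⟨m', rfl⟩ := distRingEquiv.surjective y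
  rw [← map_mul, distRingEquiv_val, distRingEquiv_val, distRingEquiv_val, mul_val_eq_conv,
    dist_conv_eq]

/-- The sum of the limit is the level-wise sum. -/
theorem add_val (x y : IwasawaRing p A) : (x + y).val = x.val + y.val := by
  obtain ⟨m, rfl⟩ := distRingEquiv.surjective x
  obtain ⟨m', rfl⟩ := distRingEquiv.surjective y
  rw [← map_add, distRingEquiv_val, distRingEquiv_val, distRingEquiv_val,
    T5AmiceRingEquiv.add_val]
  funext k c
  simp only [dist_apply, LinearMap.add_apply, Pi.add_apply]

/-- The unit of the limit is the system `(δ_{0 mod p^k})_k` — the group-ring element `[0]` at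
every level. -/
theorem one_val (k : ℕ) (c : ZMod (p ^ k)) :
    (1 : IwasawaRing p A).val k c = if c = 0 then 1 else 0 := by
  classical
  rw [← map_one (distRingEquiv (p := p) (A := A)), distRingEquiv_val,
    T5AmiceRingEquiv.one_val_eq_dirac_zero, dist_apply, T5AmiceDirac.dirac_apply,
    indicatorCM_apply (isClopen_resClass k c), Set.indicator_apply, mem_resClass_iff, map_zero,
    Pi.one_apply]
  simp only [eq_comm]

omit [Algebra ℤ_[p] A] [IsBoundedSMul ℤ_[p] A] [IsUltrametricDist A] [CompleteSpace A]
  [NormOneClass A] in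
/-- `val` is injective. -/
theorem IwasawaRing.val_injective : Function.Injective (IwasawaRing.val (p := p) (A := A)) :=
  fun _ _ h => Subtype.ext (p := fun v => v ∈ iwasawaLimit p A) h

/-- THE IWASAWA ISOMORPHISM AS RINGS (bounded parts): `lim_k A[ℤ/p^k] ≅ A[[T]]_{bounded}`. -/
noncomputable def iwasawaAmiceRing : IwasawaRing p A ≃+* boundedSeries A :=
  (distRingEquiv (p := p) (A := A)).symm.trans (amiceRingEquiv p A)

/-- `iwasawaAmiceRing x = amice (the measure of x)`. -/
theorem iwasawaAmiceRing_apply_coe (x : IwasawaRing p A) :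
    ((iwasawaAmiceRing x : boundedSeries A) : PowerSeries A) =
      T5AmiceTransform.amice ((distRingEquiv.symm x : BoundedMeasure p A) : C(ℤ_[p], A) →ₗ[A] A) := by
  simp only [iwasawaAmiceRing, RingEquiv.trans_apply, amiceRingEquiv_apply_coe]

/-- The generator γ₀ as an element of the ring. -/
noncomputable def gammaR : IwasawaRing p A := distRingEquiv (diracB p A 1)

/-- `gammaR` is the system `(δ_{1 mod p^k})_k`. -/
theorem gammaR_val (k : ℕ) (c : ZMod (p ^ k)) :
    (gammaR : IwasawaRing p A).val k c = if c = 1 then 1 else 0 := by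
  classical
  rw [gammaR, distRingEquiv_val, dist_apply]
  change (T5AmiceDirac.dirac (1 : ℤ_[p])) _ = _
  rw [T5AmiceDirac.dirac_apply, indicatorCM_apply (isClopen_resClass k c), Set.indicator_apply,
    mem_resClass_iff, map_one, Pi.one_apply]
  simp only [eq_comm]

/-- «γ₀ ↦ 1 + T» as rings. -/
theorem iwasawaAmiceRing_gammaR :
    ((iwasawaAmiceRing (gammaR : IwasawaRing p A) : boundedSeries A) : PowerSeries A) =
      1 + PowerSeries.X := by
  rw [gammaR, iwasawaAmiceRing, RingEquiv.trans_apply, RingEquiv.symm_apply_apply]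
  exact amiceRingEquiv_diracB_one p A

end Ring

section DVR

variable {A : Type*} [NormedCommRing A] [IsDomain A] [IsDiscreteValuationRing A]
  [IsUltrametricDist A] [Algebra ℤ_[p] A] [IsBoundedSMul ℤ_[p] A] [CompleteSpace A] [NormOneClass A]

/-- «W[[Γ_𝔭]] ≅ W[[T]]» AS RINGS for a discrete valuation ring W with its valuation norm, the group
ring side being the inverse limit lim_k W[ℤ/p^k] with its level-wise multiplication. -/
noncomputable def iwasawaAmiceRingDVR {r : ℝ} (hd : NormDict A r) :
    IwasawaRing p A ≃+* PowerSeries A :=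
  ((iwasawaAmiceRing (p := p) (A := A)).trans
    (RingEquiv.subringCongr (boundedSeries_eq_top_of_normDict hd))).trans Subring.topEquiv

/-- «γ₀ ↦ 1 + T» over a discrete valuation ring, as rings. -/
theorem iwasawaAmiceRingDVR_gammaR {r : ℝ} (hd : NormDict A r) :
    iwasawaAmiceRingDVR hd (gammaR : IwasawaRing p A) = 1 + PowerSeries.X := by
  rw [← iwasawaAmiceRing_gammaR (p := p) (A := A)]
  rfl

end DVR

end Summit.Ventures.HodgeRepro2.T5IwasawaLimitRing
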